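import Mathlib.Analysis.ODE.Gronwall
import Literature.Analysis.FluidPDE.GalerkinFlow
import Literature.Analysis.FluidPDE.NSGalerkinStationary
import Literature.Analysis.FluidPDE.TurbWave0
import HarnessLib

/-!
# Energy balance of the Galerkin system with a steady force, I: identity and absorbing ball

Trunk: FluidKinetic (`Literature/Analysis/FluidPDE`).  For a global solution
`α : ℝ → (S → ℂ^d)` of the Fourier–Galerkin system of the Navier–Stokes equations on the flat
torus with viscosity `ν` and CONSTANT force coefficients `g` (`IsGalerkinODESolution ν g c₀ α`,
`GalerkinFlow.lean`; Constantin–Foias 1988, Ch. 8, (8.5)–(8.6)) we record the three modal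
observables

* energy `E(t) = ∑_k ‖α_k(t)‖²` (`= ‖u(t)‖²_{L²}` for `u = realTrigPoly S ᾱ`),
* dissipation `D(t) = ν · 4π² ∑_k |k|² ‖α_k(t)‖²` (`= ν‖∇u(t)‖²`),
* injected power (work) `W(t) = ∑_k Re⟪g_k, α_k(t)⟫` (`= ∫⟪G, u(t)⟫`),

always written out as these explicit sums (no new definitions), and prove the textbook energy
bookkeeping (Constantin–Foias 1988, Ch. 8; Doering–Foias 2002, §2; Foias–Manley–Rosa–Temam 2001,
Ch. II App. A; Doering–Gibbon 1995, Ch. 7):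

* pointwise: Cauchy–Schwarz `|W| ≤ G √E` (`G = (∑‖g_k‖²)^{1/2}`), the truncation ceiling
  `D ≤ ν4π²K² E` on `S ⊆ freqBall K`, `D ≤ ν4π²(∑_{k∈S}|k|²) E`, and the differential energy
  inequality `2(W − D) ≤ −4π²ν E + G²/(4π²ν)` on `S ∌ 0` (Poincaré + Young);
* `hasDerivWithinAt_energy_balance` — `dE/dt = 2 (W − D)` (the tree's `hasDerivWithinAt_energy`
  with dissipation and power on the Fourier side);
* `IsGalerkinODESolution.energy_sub_energy_eq` — `E(T) − E(0) = 2 (∫₀ᵀ W − ∫₀ᵀ D)`;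
* `IsGalerkinODESolution.timeMean_dissipation_eq` — `⟨D⟩_T = ⟨W⟩_T + (E(0) − E(T))/(2T)`;
* `IsGalerkinODESolution.energy_le_gronwall` / `energy_le_max` / `energy_le_of_le` — on a frequency
  set without mean mode and `ν > 0`: `E(t) ≤ ρ_* + (E(0) − ρ_*) e^{−4π²ν t}`,
  `ρ_* = (∑‖g_k‖²)/(4π²ν)²`, hence `E(t) ≤ max (E 0) ρ_*` and forward invariance of the energy
  balls `{E ≤ R}`, `R ≥ ρ_*` (Constantin–Foias 1988, (8.7)–(8.9));
* `IsGalerkinODESolution.abs_work_le` / `dissipation_le` — the resulting uniform bounds on `W`, `D`;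
* `isGalerkinODESolution_const` — zeros of the Galerkin field are (constant) solutions.

Long-time averages (`⟨D⟩ = ⟨W⟩`, the energy row, cone ⇒ window) are in
`GalerkinEnergyBalanceLongTime.lean`.  Deliberately NOT here: anything about `S ↑ ℤ^d`.

## References
* P. Constantin, C. Foias, *Navier–Stokes Equations*, Univ. Chicago Press (1988), Ch. 8. [ConstantinFoias1988]
* C. R. Doering, C. Foias, Energy dissipation in body-forced turbulence, JFM 467 (2002), §2. [DoeringFoias2002]
* C. Foias, O. Manley, R. Rosa, R. Temam, *Navier–Stokes Equations and Turbulence*, CUP (2001), Ch. II. [FoiasManleyRosaTemam2001]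
-/

open MeasureTheory Set Filter Topology
open scoped InnerProductSpace RealInnerProductSpace

noncomputable section

namespace Literature.Analysis.FluidPDE

/-- A real function continuous on `[0, ∞)` is integrable on every `(0, T]`. [folklore] -/
theorem integrableOn_Ioc_of_continuousOn_Ici {f : ℝ → ℝ} (hf : ContinuousOn f (Ici 0)) (T : ℝ) :
    IntegrableOn f (Ioc 0 T) :=
  ((hf.mono Icc_subset_Ici_self).integrableOn_Icc (a := 0) (b := T)).mono_set Ioc_subset_Icc_self

/-- A real function continuous on `[0, ∞)` is interval integrable on `[0, T]`, `T ≥ 0`. [folklore] -/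
theorem intervalIntegrable_of_continuousOn_Ici {f : ℝ → ℝ} (hf : ContinuousOn f (Ici 0)) {T : ℝ}
    (hT : 0 ≤ T) : IntervalIntegrable f volume 0 T :=
  (hf.mono (by rw [uIcc_of_le hT]; exact Icc_subset_Ici_self)).intervalIntegrable

section Balance

open FunctionSpaces.Torus Torus

variable {d : Type*} [Fintype d] [DecidableEq d] {S : Finset (d → ℤ)} {ν : ℝ}
  {g c₀ : ↥S → EuclideanSpace ℂ d} {α : ℝ → ↥S → EuclideanSpace ℂ d}
/-! ## Pointwise inequalities between the three observables -/

omit [DecidableEq d] in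
/-- **Cauchy–Schwarz for the injected power**: `|∑_k Re⟪g_k, w_k⟫| ≤ (∑‖g_k‖²)^{1/2} (∑‖w_k‖²)^{1/2}`. [folklore] -/
theorem abs_sum_re_inner_le_sqrt_mul_sqrt (g w : ↥S → EuclideanSpace ℂ d) :
    |∑ k, (inner ℂ (g k) (w k)).re| ≤ Real.sqrt (∑ k, ‖g k‖ ^ 2) * Real.sqrt (∑ k, ‖w k‖ ^ 2) := by
  have h1 : |∑ k, (inner ℂ (g k) (w k)).re| ≤ ∑ k, ‖g k‖ * ‖w k‖ := by
    refine (Finset.abs_sum_le_sum_abs _ _).trans (Finset.sum_le_sum fun k _ => ?_)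
    exact (Complex.abs_re_le_norm _).trans (norm_inner_le_norm _ _)
  refine h1.trans ?_
  rw [← Real.sqrt_mul (Finset.sum_nonneg fun k _ => sq_nonneg _)]
  exact Real.le_sqrt_of_sq_le (Finset.sum_mul_sq_le_sq_mul_sq _ _ _)

omit [DecidableEq d] in
/-- Squared form: `(∑_k Re⟪g_k, w_k⟫)² ≤ (∑‖g_k‖²) (∑‖w_k‖²)`. [folklore] -/
theorem sum_re_inner_sq_le (g w : ↥S → EuclideanSpace ℂ d) :
    (∑ k, (inner ℂ (g k) (w k)).re) ^ 2 ≤ (∑ k, ‖g k‖ ^ 2) * ∑ k, ‖w k‖ ^ 2 := by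
  have h := abs_sum_re_inner_le_sqrt_mul_sqrt g w
  have hg : 0 ≤ ∑ k, ‖g k‖ ^ 2 := Finset.sum_nonneg fun k _ => sq_nonneg _
  have hw : 0 ≤ ∑ k, ‖w k‖ ^ 2 := Finset.sum_nonneg fun k _ => sq_nonneg _
  calc (∑ k, (inner ℂ (g k) (w k)).re) ^ 2 = |∑ k, (inner ℂ (g k) (w k)).re| ^ 2 := (sq_abs _).symm
    _ ≤ (Real.sqrt (∑ k, ‖g k‖ ^ 2) * Real.sqrt (∑ k, ‖w k‖ ^ 2)) ^ 2 :=
        pow_le_pow_left₀ (abs_nonneg _) h 2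
    _ = (∑ k, ‖g k‖ ^ 2) * ∑ k, ‖w k‖ ^ 2 := by
        rw [mul_pow, Real.sq_sqrt hg, Real.sq_sqrt hw]

/-- **The truncation ceiling**: on `S ⊆ freqBall K` the dissipation is at most `ν·4π²K²` times
the energy (`|k|² ≤ K²` termwise). [folklore] -/
theorem dissipation_le_of_subset_freqBall {K : ℕ} (hSK : S ⊆ freqBall K) (hν : 0 ≤ ν)
    (w : ↥S → EuclideanSpace ℂ d) :
    ν * (4 * Real.pi ^ 2 * ∑ k : ↥S, freqNormSq (k : d → ℤ) * ‖w k‖ ^ 2) ≤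
      ν * (4 * Real.pi ^ 2 * (K : ℝ) ^ 2) * ∑ k, ‖w k‖ ^ 2 := by
  have hk : ∀ k : ↥S, freqNormSq (k : d → ℤ) ≤ (K : ℝ) ^ 2 := fun k => mem_freqBall.1 (hSK k.2)
  have hsum : ∑ k : ↥S, freqNormSq (k : d → ℤ) * ‖w k‖ ^ 2 ≤ ∑ k : ↥S, (K : ℝ) ^ 2 * ‖w k‖ ^ 2 :=
    Finset.sum_le_sum fun k _ => mul_le_mul_of_nonneg_right (hk k) (sq_nonneg _)
  calc ν * (4 * Real.pi ^ 2 * ∑ k : ↥S, freqNormSq (k : d → ℤ) * ‖w k‖ ^ 2)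
      ≤ ν * (4 * Real.pi ^ 2 * ∑ k : ↥S, (K : ℝ) ^ 2 * ‖w k‖ ^ 2) := by gcongr
    _ = ν * (4 * Real.pi ^ 2 * (K : ℝ) ^ 2) * ∑ k, ‖w k‖ ^ 2 := by rw [← Finset.mul_sum]; ring

omit [DecidableEq d] in
/-- The dissipation is controlled by the energy on any finite frequency set:
`D ≤ ν·4π²·(∑_{k∈S}|k|²)·E` (`|k|² ≤ ∑_{k'∈S} |k'|²` termwise). [folklore] -/
theorem dissipation_le_mul_energy (hν : 0 ≤ ν) (w : ↥S → EuclideanSpace ℂ d) :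
    ν * (4 * Real.pi ^ 2 * ∑ k : ↥S, freqNormSq (k : d → ℤ) * ‖w k‖ ^ 2) ≤
      ν * (4 * Real.pi ^ 2 * ∑ k' ∈ S, freqNormSq k') * ∑ k, ‖w k‖ ^ 2 := by
  have hsum : ∑ k : ↥S, freqNormSq (k : d → ℤ) * ‖w k‖ ^ 2 ≤
      ∑ k : ↥S, (∑ k' ∈ S, freqNormSq k') * ‖w k‖ ^ 2 :=
    Finset.sum_le_sum fun k _ => mul_le_mul_of_nonneg_right (freqNormSq_le_sum k.2) (sq_nonneg _)
  calc ν * (4 * Real.pi ^ 2 * ∑ k : ↥S, freqNormSq (k : d → ℤ) * ‖w k‖ ^ 2)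
      ≤ ν * (4 * Real.pi ^ 2 * ∑ k : ↥S, (∑ k' ∈ S, freqNormSq k') * ‖w k‖ ^ 2) := by gcongr
    _ = ν * (4 * Real.pi ^ 2 * ∑ k' ∈ S, freqNormSq k') * ∑ k, ‖w k‖ ^ 2 := by
        rw [← Finset.mul_sum]; ring

omit [DecidableEq d] in
/-- **The energy inequality in differential form** (Poincaré on `S ∌ 0` + Young): for a coefficient
vector `w` on a frequency set without mean mode and `ν > 0`,
`2 (W − D) ≤ −4π²ν E + (∑‖g_k‖²)/(4π²ν)`. [folklore] -/
theorem two_mul_work_sub_dissipation_le (hS0 : (0 : d → ℤ) ∉ S) (hν : 0 < ν)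
    (g w : ↥S → EuclideanSpace ℂ d) :
    2 * ((∑ k, (inner ℂ (g k) (w k)).re) -
        ν * (4 * Real.pi ^ 2 * ∑ k : ↥S, freqNormSq (k : d → ℤ) * ‖w k‖ ^ 2)) ≤
      -(4 * Real.pi ^ 2 * ν) * (∑ k, ‖w k‖ ^ 2) + (∑ k, ‖g k‖ ^ 2) / (4 * Real.pi ^ 2 * ν) := by
  have hlam : 0 < 4 * Real.pi ^ 2 * ν := by positivity
  -- Poincaré
  have hP : (4 * Real.pi ^ 2 * ν) * ∑ k, ‖w k‖ ^ 2 ≤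
      ν * (4 * Real.pi ^ 2 * ∑ k : ↥S, freqNormSq (k : d → ℤ) * ‖w k‖ ^ 2) := by
    have h1 := sum_norm_sq_le_sum_freqNormSq_mul hS0 w
    calc (4 * Real.pi ^ 2 * ν) * ∑ k, ‖w k‖ ^ 2 = ν * (4 * Real.pi ^ 2 * ∑ k, ‖w k‖ ^ 2) := by ring
      _ ≤ ν * (4 * Real.pi ^ 2 * ∑ k : ↥S, freqNormSq (k : d → ℤ) * ‖w k‖ ^ 2) := by gcongr
  -- Young, termwise
  have hY : ∀ k : ↥S, 2 * (inner ℂ (g k) (w k)).re ≤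
      (4 * Real.pi ^ 2 * ν) * ‖w k‖ ^ 2 + ‖g k‖ ^ 2 / (4 * Real.pi ^ 2 * ν) := by
    intro k
    have h1 : (inner ℂ (g k) (w k)).re ≤ ‖g k‖ * ‖w k‖ := by
      simpa using re_inner_le_norm (𝕜 := ℂ) (g k) (w k)
    have h2 : 2 * (‖g k‖ * ‖w k‖) ≤
        (4 * Real.pi ^ 2 * ν) * ‖w k‖ ^ 2 + ‖g k‖ ^ 2 / (4 * Real.pi ^ 2 * ν) := by
      rw [← sub_nonneg]
      have : (4 * Real.pi ^ 2 * ν) * ‖w k‖ ^ 2 + ‖g k‖ ^ 2 / (4 * Real.pi ^ 2 * ν) -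
          2 * (‖g k‖ * ‖w k‖) = ((4 * Real.pi ^ 2 * ν) * ‖w k‖ - ‖g k‖) ^ 2 / (4 * Real.pi ^ 2 * ν) := by
        field_simp
        ring
      rw [this]
      positivity
    linarith
  have hW : 2 * ∑ k, (inner ℂ (g k) (w k)).re ≤
      (4 * Real.pi ^ 2 * ν) * (∑ k, ‖w k‖ ^ 2) + (∑ k, ‖g k‖ ^ 2) / (4 * Real.pi ^ 2 * ν) := by
    rw [Finset.mul_sum, Finset.mul_sum, Finset.sum_div, ← Finset.sum_add_distrib]
    exact Finset.sum_le_sum fun k _ => hY k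
  linarith

/-! ## The energy identity along a Galerkin solution -/

/-- **`dE/dt = 2(W − D)`** along any curve solving the Galerkin ODE within `s` at `t` through a
point of the phase space, for real force coefficients (the tree's `hasDerivWithinAt_energy` with
`ν‖∇u‖² = ν·4π²∑|k|²‖α_k‖²` and `∫⟪G, u⟫ = ∑ Re⟪g_k, α_k⟫`). [folklore] -/
theorem hasDerivWithinAt_energy_balance (ν : ℝ) (hS : ∀ k ∈ S, -k ∈ S)
    (hg : IsRealCoeff g) {β : ℝ → ↥S → EuclideanSpace ℂ d} {s : Set ℝ} {t : ℝ}
    (h : HasDerivWithinAt β (galerkinRHS S ν g (β t)) s t) (hβ : β t ∈ galerkinSubspace S) :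
    HasDerivWithinAt (fun τ => ∑ k, ‖β τ k‖ ^ 2)
      (2 * ((∑ k, (inner ℂ (g k) (β t k)).re) -
        ν * (4 * Real.pi ^ 2 * ∑ k : ↥S, freqNormSq (k : d → ℤ) * ‖β t k‖ ^ 2))) s t := by
  have h1 := hasDerivWithinAt_energy ν hS h hβ hg
  have hW : ∫ x, ⟪realTrigPoly S (coeffExt S g) x, realTrigPoly S (coeffExt S (β t)) x⟫_ℝ =
      ∑ k, (inner ℂ (g k) (β t k)).re := by
    rw [integral_inner_realTrigPoly_realTrigPoly hS (hg.isConjSymm_coeffExt hS)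
      (hβ.1.isConjSymm_coeffExt hS), ← Finset.sum_coe_sort]
    exact Finset.sum_congr rfl fun k _ => by rw [coeffExt_coe, coeffExt_coe]
  rw [toReal_eGradNormSq_coeffExt hS hβ.1, hW] at h1
  convert h1 using 1
  ring

namespace IsGalerkinODESolution

/-! ### Continuity of the observables along a solution -/

omit [DecidableEq d] in
/-- Each mode of a solution is continuous on `[0, ∞)`. [folklore] -/
theorem continuousOn_apply (hα : IsGalerkinODESolution ν g c₀ α) (k : ↥S) :
    ContinuousOn (fun t => α t k) (Ici 0) :=
  (continuous_apply k).comp_continuousOn hα.continuousOn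

omit [DecidableEq d] in
/-- The energy is continuous on `[0, ∞)`. [folklore] -/
theorem continuousOn_energy (hα : IsGalerkinODESolution ν g c₀ α) :
    ContinuousOn (fun t => ∑ k, ‖α t k‖ ^ 2) (Ici 0) :=
  continuousOn_finsetSum _ fun k _ => ((hα.continuousOn_apply k).norm).pow 2

omit [DecidableEq d] in
/-- The dissipation is continuous on `[0, ∞)`. [folklore] -/
theorem continuousOn_dissipation (hα : IsGalerkinODESolution ν g c₀ α) :
    ContinuousOn (fun t => ν * (4 * Real.pi ^ 2 * ∑ k : ↥S, freqNormSq (k : d → ℤ) * ‖α t k‖ ^ 2))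
      (Ici 0) :=
  continuousOn_const.mul (continuousOn_const.mul (continuousOn_finsetSum _ fun k _ =>
    continuousOn_const.mul (((hα.continuousOn_apply k).norm).pow 2)))

omit [DecidableEq d] in
/-- The injected power is continuous on `[0, ∞)`. [folklore] -/
theorem continuousOn_work (hα : IsGalerkinODESolution ν g c₀ α) :
    ContinuousOn (fun t => ∑ k, (inner ℂ (g k) (α t k)).re) (Ici 0) :=
  continuousOn_finsetSum _ fun k _ =>
    Complex.continuous_re.comp_continuousOn (continuousOn_const.inner (hα.continuousOn_apply k))

/-! ### The energy identity, integrated -/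

/-- **The energy identity on `[0, T]`**: `E(T) − E(0) = 2 (∫₀ᵀ W − ∫₀ᵀ D)`
(Robinson–Rodrigo–Sadowski 2016, (4.6)–(4.7); Constantin–Foias 1988, (8.7)). [cite: ConstantinFoias1988, Ch. 8 (8.7)] -/
theorem energy_sub_energy_eq (hα : IsGalerkinODESolution ν g c₀ α) (hS : ∀ k ∈ S, -k ∈ S)
    (hg : IsRealCoeff g) {T : ℝ} (hT : 0 ≤ T) :
    (∑ k, ‖α T k‖ ^ 2) - ∑ k, ‖α 0 k‖ ^ 2 =
      2 * ((∫ t in (0 : ℝ)..T, ∑ k, (inner ℂ (g k) (α t k)).re) -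
        ∫ t in (0 : ℝ)..T, ν * (4 * Real.pi ^ 2 * ∑ k : ↥S, freqNormSq (k : d → ℤ) * ‖α t k‖ ^ 2)) := by
  have hderiv : ∀ t ∈ Icc 0 T, HasDerivWithinAt (fun τ => ∑ k, ‖α τ k‖ ^ 2)
      (2 * ((∑ k, (inner ℂ (g k) (α t k)).re) -
        ν * (4 * Real.pi ^ 2 * ∑ k : ↥S, freqNormSq (k : d → ℤ) * ‖α t k‖ ^ 2))) (Icc 0 T) t :=
    fun t ht => hasDerivWithinAt_energy_balance ν hS hg (hα.hasDerivWithinAt T t ht) (hα.mem t)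
  have hWint := intervalIntegrable_of_continuousOn_Ici hα.continuousOn_work hT
  have hDint := intervalIntegrable_of_continuousOn_Ici hα.continuousOn_dissipation hT
  have hFTC : ∫ t in (0 : ℝ)..T, 2 * ((∑ k, (inner ℂ (g k) (α t k)).re) -
      ν * (4 * Real.pi ^ 2 * ∑ k : ↥S, freqNormSq (k : d → ℤ) * ‖α t k‖ ^ 2)) =
        (∑ k, ‖α T k‖ ^ 2) - ∑ k, ‖α 0 k‖ ^ 2 := by
    refine intervalIntegral.integral_eq_sub_of_hasDeriv_right_of_le hT
      (hα.continuousOn_energy.mono Icc_subset_Ici_self) ?_ ((hWint.sub hDint).const_mul 2)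
    intro t ht
    exact ((hderiv t ⟨ht.1.le, ht.2.le⟩).hasDerivAt (Icc_mem_nhds ht.1 ht.2)).hasDerivWithinAt
  rw [← hFTC, intervalIntegral.integral_const_mul, intervalIntegral.integral_sub hWint hDint]

/-- **The energy identity in running-mean form**: for `T > 0`,
`⟨D⟩_T = ⟨W⟩_T + (E(0) − E(T)) / (2T)` (Doering–Foias 2002, §2, (2.4)–(2.6) at the Galerkin level). [cite: DoeringFoias2002, §2] -/
theorem timeMean_dissipation_eq (hα : IsGalerkinODESolution ν g c₀ α) (hS : ∀ k ∈ S, -k ∈ S)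
    (hg : IsRealCoeff g) {T : ℝ} (hT : 0 < T) :
    timeMean (fun t => ν * (4 * Real.pi ^ 2 * ∑ k : ↥S, freqNormSq (k : d → ℤ) * ‖α t k‖ ^ 2)) T =
      timeMean (fun t => ∑ k, (inner ℂ (g k) (α t k)).re) T +
        ((∑ k, ‖α 0 k‖ ^ 2) - ∑ k, ‖α T k‖ ^ 2) / (2 * T) := by
  have h := hα.energy_sub_energy_eq hS hg hT.le
  have hD : ∫ t in (0 : ℝ)..T, ν * (4 * Real.pi ^ 2 * ∑ k : ↥S, freqNormSq (k : d → ℤ) * ‖α t k‖ ^ 2) =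
      (∫ t in (0 : ℝ)..T, ∑ k, (inner ℂ (g k) (α t k)).re) +
        ((∑ k, ‖α 0 k‖ ^ 2) - ∑ k, ‖α T k‖ ^ 2) / 2 := by
    linarith
  unfold timeMean
  rw [hD, mul_add]
  congr 1
  field_simp

/-! ### The absorbing ball (no mean mode, `ν > 0`) -/

/-- **Exponential relaxation of the energy to the absorbing level** (Grönwall on
`dE/dt ≤ −4π²ν E + (∑‖g_k‖²)/(4π²ν)`): on a frequency set without mean mode, for `ν > 0` and `t ≥ 0`,
`E(t) ≤ ρ_* + (E(0) − ρ_*) e^{−4π²ν t}`, `ρ_* = (∑‖g_k‖²)/(4π²ν)²`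
(Constantin–Foias 1988, (8.7)–(8.9); Foias–Manley–Rosa–Temam 2001, Ch. II (A.46)). [cite: ConstantinFoias1988, Ch. 8 (8.7)–(8.9)] -/
theorem energy_le_gronwall (hα : IsGalerkinODESolution ν g c₀ α) (hν : 0 < ν)
    (hS : ∀ k ∈ S, -k ∈ S) (hS0 : (0 : d → ℤ) ∉ S) (hg : IsRealCoeff g) {t : ℝ} (ht : 0 ≤ t) :
    ∑ k, ‖α t k‖ ^ 2 ≤
      (∑ k, ‖g k‖ ^ 2) / (4 * Real.pi ^ 2 * ν) ^ 2 +
        ((∑ k, ‖α 0 k‖ ^ 2) - (∑ k, ‖g k‖ ^ 2) / (4 * Real.pi ^ 2 * ν) ^ 2) *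
          Real.exp (-(4 * Real.pi ^ 2 * ν) * t) := by
  have hlam : 0 < 4 * Real.pi ^ 2 * ν := by positivity
  set lam : ℝ := 4 * Real.pi ^ 2 * ν with hlam_def
  set G2 : ℝ := ∑ k, ‖g k‖ ^ 2 with hG2
  have hder : ∀ x ∈ Ico 0 t, HasDerivWithinAt (fun τ => ∑ k, ‖α τ k‖ ^ 2)
      (2 * ((∑ k, (inner ℂ (g k) (α x k)).re) -
        ν * (4 * Real.pi ^ 2 * ∑ k : ↥S, freqNormSq (k : d → ℤ) * ‖α x k‖ ^ 2))) (Ici x) x :=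
    fun x hx => hasDerivWithinAt_energy_balance ν hS hg (hα.hasDerivWithinAt_Ici hx) (hα.mem x)
  have hG := le_gronwallBound_of_liminf_deriv_right_le (δ := ∑ k, ‖α 0 k‖ ^ 2) (K := -lam)
    (ε := G2 / lam) (a := 0) (b := t) (hα.continuousOn_energy.mono Icc_subset_Ici_self)
    (fun x hx r hr => (hder x hx).liminf_right_slope_le hr) le_rfl
    (fun x _ => by
      have h := two_mul_work_sub_dissipation_le hS0 hν g (α x)
      rw [← hlam_def, ← hG2] at h
      linarith)
    t ⟨ht, le_rfl⟩
  rw [sub_zero, gronwallBound_of_K_ne_0 (neg_ne_zero.2 hlam.ne')] at hG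
  refine hG.trans (le_of_eq ?_)
  rw [hlam_def] at *
  field_simp
  ring

/-- **The absorbing bound**: `E(t) ≤ max (E 0) ((∑‖g_k‖²)/(4π²ν)²)` for all `t ≥ 0`
(no mean mode, `ν > 0`). [cite: ConstantinFoias1988, Ch. 8 (8.9)] -/
theorem energy_le_max (hα : IsGalerkinODESolution ν g c₀ α) (hν : 0 < ν)
    (hS : ∀ k ∈ S, -k ∈ S) (hS0 : (0 : d → ℤ) ∉ S) (hg : IsRealCoeff g) {t : ℝ} (ht : 0 ≤ t) :
    ∑ k, ‖α t k‖ ^ 2 ≤ max (∑ k, ‖α 0 k‖ ^ 2) ((∑ k, ‖g k‖ ^ 2) / (4 * Real.pi ^ 2 * ν) ^ 2) := by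
  have h := hα.energy_le_gronwall hν hS hS0 hg ht
  set e : ℝ := Real.exp (-(4 * Real.pi ^ 2 * ν) * t) with he
  set M : ℝ := max (∑ k, ‖α 0 k‖ ^ 2) ((∑ k, ‖g k‖ ^ 2) / (4 * Real.pi ^ 2 * ν) ^ 2) with hM
  have he0 : 0 ≤ e := Real.exp_nonneg _
  have he1 : e ≤ 1 := by
    rw [he]
    refine Real.exp_le_one_iff.2 ?_
    have : 0 ≤ 4 * Real.pi ^ 2 * ν * t := by positivity
    linarith
  have h1 : ∑ k, ‖α 0 k‖ ^ 2 ≤ M := le_max_left _ _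
  have h2 : (∑ k, ‖g k‖ ^ 2) / (4 * Real.pi ^ 2 * ν) ^ 2 ≤ M := le_max_right _ _
  refine h.trans ?_
  nlinarith [mul_le_mul_of_nonneg_left h1 he0, mul_le_mul_of_nonneg_left h2 (sub_nonneg.2 he1)]

/-- **Forward invariance of the energy balls**: if `E(0) ≤ R` and `R ≥ (∑‖g_k‖²)/(4π²ν)²` then
`E(t) ≤ R` for all `t ≥ 0` (no mean mode, `ν > 0`). [cite: ConstantinFoias1988, Ch. 8 (8.9)] -/
theorem energy_le_of_le (hα : IsGalerkinODESolution ν g c₀ α) (hν : 0 < ν)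
    (hS : ∀ k ∈ S, -k ∈ S) (hS0 : (0 : d → ℤ) ∉ S) (hg : IsRealCoeff g) {R : ℝ}
    (hR : (∑ k, ‖g k‖ ^ 2) / (4 * Real.pi ^ 2 * ν) ^ 2 ≤ R) (h0 : ∑ k, ‖α 0 k‖ ^ 2 ≤ R)
    {t : ℝ} (ht : 0 ≤ t) : ∑ k, ‖α t k‖ ^ 2 ≤ R :=
  (hα.energy_le_max hν hS hS0 hg ht).trans (max_le h0 hR)

omit [DecidableEq d] in
/-- The energy is nonnegative. [folklore] -/
theorem energy_nonneg (α : ℝ → ↥S → EuclideanSpace ℂ d) (t : ℝ) : 0 ≤ ∑ k, ‖α t k‖ ^ 2 :=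
  Finset.sum_nonneg fun _ _ => sq_nonneg _

omit [DecidableEq d] in
/-- The dissipation is nonnegative for `ν ≥ 0`. [folklore] -/
theorem dissipation_nonneg (hν : 0 ≤ ν) (α : ℝ → ↥S → EuclideanSpace ℂ d) (t : ℝ) :
    0 ≤ ν * (4 * Real.pi ^ 2 * ∑ k : ↥S, freqNormSq (k : d → ℤ) * ‖α t k‖ ^ 2) :=
  mul_nonneg hν (mul_nonneg (by positivity)
    (Finset.sum_nonneg fun k _ => mul_nonneg (freqNormSq_nonneg _) (sq_nonneg _)))

/-! ### Uniform bounds on the injected power and the dissipation -/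

/-- The injected power along a solution is bounded:
`|W(t)| ≤ G · (max (E 0) ρ_*)^{1/2}` for `t ≥ 0` (no mean mode, `ν > 0`). [folklore] -/
theorem abs_work_le (hα : IsGalerkinODESolution ν g c₀ α) (hν : 0 < ν)
    (hS : ∀ k ∈ S, -k ∈ S) (hS0 : (0 : d → ℤ) ∉ S) (hg : IsRealCoeff g) {t : ℝ} (ht : 0 ≤ t) :
    |∑ k, (inner ℂ (g k) (α t k)).re| ≤ Real.sqrt (∑ k, ‖g k‖ ^ 2) *
      Real.sqrt (max (∑ k, ‖α 0 k‖ ^ 2) ((∑ k, ‖g k‖ ^ 2) / (4 * Real.pi ^ 2 * ν) ^ 2)) :=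
  (abs_sum_re_inner_le_sqrt_mul_sqrt g (α t)).trans (mul_le_mul_of_nonneg_left
    (Real.sqrt_le_sqrt (hα.energy_le_max hν hS hS0 hg ht)) (Real.sqrt_nonneg _))

/-- The dissipation along a solution is bounded:
`D(t) ≤ ν·4π²·(∑_{k∈S}|k|²) · max (E 0) ρ_*` for `t ≥ 0` (no mean mode, `ν > 0`). [folklore] -/
theorem dissipation_le (hα : IsGalerkinODESolution ν g c₀ α) (hν : 0 < ν)
    (hS : ∀ k ∈ S, -k ∈ S) (hS0 : (0 : d → ℤ) ∉ S) (hg : IsRealCoeff g) {t : ℝ} (ht : 0 ≤ t) :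
    ν * (4 * Real.pi ^ 2 * ∑ k : ↥S, freqNormSq (k : d → ℤ) * ‖α t k‖ ^ 2) ≤
      ν * (4 * Real.pi ^ 2 * ∑ k' ∈ S, freqNormSq k') *
        max (∑ k, ‖α 0 k‖ ^ 2) ((∑ k, ‖g k‖ ^ 2) / (4 * Real.pi ^ 2 * ν) ^ 2) :=
  (dissipation_le_mul_energy hν.le (α t)).trans (mul_le_mul_of_nonneg_left
    (hα.energy_le_max hν hS hS0 hg ht) (mul_nonneg hν.le (mul_nonneg (by positivity)
      (Finset.sum_nonneg fun k _ => freqNormSq_nonneg _))))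

/-! ### Steady states -/

omit [DecidableEq d] in
/-- **A zero of the Galerkin field in the phase space is a (constant) global solution.** [folklore] -/
theorem _root_.Literature.Analysis.FluidPDE.isGalerkinODESolution_const [DecidableEq d]
    {a : ↥S → EuclideanSpace ℂ d} (ha : a ∈ galerkinSubspace S) (h0 : galerkinRHS S ν g a = 0) :
    IsGalerkinODESolution ν g a (fun _ => a) where
  initial := rfl
  mem _ := ha
  continuousOn := continuousOn_const
  hasDerivWithinAt T t _ := by
    rw [h0]
    exact hasDerivWithinAt_const t (Icc 0 T) a

end IsGalerkinODESolution

end Balance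

end Literature.Analysis.FluidPDE

end
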